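import Summits.NavierStokesRegularity.NavierStokesRegularity.Theorems.OddMorawetzMorawetzKillsTypeIOrderThreeLive
import Summits.NavierStokesRegularity.NavierStokesRegularity.Theorems.OddMorawetzLocal.Negative.OddMorawetzLocalB3Reduction
import Literature.Analysis.Calculus.IteratedFDerivSymmetric

/-!
# `stub_isoAssembleThree`: the weight-3 endgame of the isotropy cut
  (crux `OddMorawetz.MorawetzKillsTypeI`, stmt-NavierStokesRegularity-1377, line `registered`)

Stub `stub_isoAssembleThree` of the lead's skeleton of the crux
`Summit.NavierStokesRegularity.NavierStokesRegularity.Theses.OddMorawetz.MorawetzKillsTypeI`.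

**Statement.** Let `m` be a smooth density on 3-jets carrying a Morawetz certificate (`Q_m v ≥ 0` for every
divergence-free Schwartz field `v`, `> 0` once), where `Q_m v = -∫ Dm(J v x)[J B(v,v) x] dx`, `J` the 3-jet map and
`B` the Euler bilinear form. Suppose that on SYMMETRIC jets `m = ∑ₗ dₗ Iₗ` for seventeen `C¹` densities `Iₗ`
(structure), and that each `Iₗ - αₗ r` has vanishing Euler derivative on divergence-free Schwartz fields (nullity),
`r(z) = ⟪ω(z₁), z₁ ω(z₁)⟫` the enstrophy-production density. Then `False`.

**Proof.**
* Jets of smooth fields are symmetric (Schwarz/Clairaut, `Literature.Analysis.Calculus`), and the symmetric jets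
  form a linear subspace; two differentiable densities agreeing on it have equal derivatives there along symmetric
  directions (restrict to the line `z + t w`; `lineDeriv`). Hence pointwise
  `Dm(J v x)[J b x] = ∑ₗ dₗ D Iₗ(J v x)[J b x]` (`IsoAssembleThree.fderiv_jet_eq_sum`).
* Each `x ↦ D Iₗ(J v x)[J b x]` and `x ↦ D r(J v x)[J b x]` is integrable (`integrable_fderiv_jets`), so by nullity and
  linearity `∫ D Iₗ = αₗ ∫ D r`, whence `Q_m v = (∑ₗ dₗ αₗ) · Q_r v` (`IsoAssembleThree.integral_jet_eq_mul`).
* `Q_r` takes both signs (the landed `stub_orderThreeLive`), so `Q_m ≥ 0` forces `∑ₗ dₗ αₗ = 0`, i.e. `Q_m ≡ 0` on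
  divergence-free Schwartz fields, contradicting strictness (`IsoAssembleThree.sign_contra`).

No definitions, no named facts; everything proved.
-/

noncomputable section

open MeasureTheory
open scoped RealInnerProductSpace

-- the problem namespace `Summit.NavierStokesRegularity.NavierStokesRegularity` repeats the summit name by design
set_option linter.dupNamespace false

namespace Summit.NavierStokesRegularity.NavierStokesRegularity.Theorems

open Summit.NavierStokesRegularity.NavierStokesRegularity.Theorems.OddMorawetz
open Literature.Analysis Literature.Analysis.FluidPDE

namespace IsoAssembleThree

/-- Two differentiable functions which agree on a set stable under `z ↦ z + t • w` (for `w` in the set) have the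
same derivative at points of the set along directions of the set (restrict both to the line `t ↦ z + t • w`). -/
theorem fderiv_eq_of_eqOn {E : Type*} [NormedAddCommGroup E] [NormedSpace ℝ E] {P : E → Prop}
    (hP : ∀ (z w : E) (t : ℝ), P z → P w → P (z + t • w)) {m₁ m₂ : E → ℝ}
    (h₁ : Differentiable ℝ m₁) (h₂ : Differentiable ℝ m₂) (heq : ∀ z, P z → m₁ z = m₂ z)
    {z w : E} (hz : P z) (hw : P w) : fderiv ℝ m₁ z w = fderiv ℝ m₂ z w := by
  rw [← (h₁ z).lineDeriv_eq_fderiv, ← (h₂ z).lineDeriv_eq_fderiv]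
  unfold lineDeriv
  congr 1
  funext t
  exact heq _ (hP z w t hz hw)

/-- The symmetric 3-jets (symmetric second and third components) are stable under `z ↦ z + t • w`. -/
theorem symm_add_smul {z w : Jet3}
    (hz : (∀ (h : Fin 2 → E3) (σ : Equiv.Perm (Fin 2)), z.2.2.1 (h ∘ σ) = z.2.2.1 h) ∧
      (∀ (h : Fin 3 → E3) (σ : Equiv.Perm (Fin 3)), z.2.2.2 (h ∘ σ) = z.2.2.2 h))
    (hw : (∀ (h : Fin 2 → E3) (σ : Equiv.Perm (Fin 2)), w.2.2.1 (h ∘ σ) = w.2.2.1 h) ∧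
      (∀ (h : Fin 3 → E3) (σ : Equiv.Perm (Fin 3)), w.2.2.2 (h ∘ σ) = w.2.2.2 h)) (t : ℝ) :
    (∀ (h : Fin 2 → E3) (σ : Equiv.Perm (Fin 2)), (z + t • w).2.2.1 (h ∘ σ) = (z + t • w).2.2.1 h) ∧
      (∀ (h : Fin 3 → E3) (σ : Equiv.Perm (Fin 3)), (z + t • w).2.2.2 (h ∘ σ) = (z + t • w).2.2.2 h) := by
  refine ⟨fun h σ => ?_, fun h σ => ?_⟩
  · simp only [Prod.snd_add, Prod.fst_add, Prod.smul_snd, Prod.smul_fst, add_apply, smul_apply, hz.1 h σ, hw.1 h σ]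
  · simp only [Prod.snd_add, Prod.smul_snd, add_apply, smul_apply, hz.2 h σ, hw.2 h σ]

/-- Jets of smooth fields are symmetric (equality of mixed partials). -/
theorem symm_jet {u : E3 → E3} (hu : ContDiff ℝ (⊤ : ℕ∞) u) (x : E3) :
    (∀ (h : Fin 2 → E3) (σ : Equiv.Perm (Fin 2)), iteratedFDeriv ℝ 2 u x (h ∘ σ) = iteratedFDeriv ℝ 2 u x h) ∧
      (∀ (h : Fin 3 → E3) (σ : Equiv.Perm (Fin 3)), iteratedFDeriv ℝ 3 u x (h ∘ σ) = iteratedFDeriv ℝ 3 u x h) :=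
  ⟨fun h σ => Calculus.iteratedFDeriv_comp_perm_of_contDiff hu (WithTop.coe_le_coe.2 le_top) x h σ,
    fun h σ => Calculus.iteratedFDeriv_comp_perm_of_contDiff hu (WithTop.coe_le_coe.2 le_top) x h σ⟩

/-- **Pointwise step.** If `m = ∑ₗ dₗ Iₗ` on a set of jets `P` which is stable under lines and contains the jets of
smooth fields, then along a Schwartz field `v` (with `b = B(v,v)`, smooth by `contDiff_eulerBilinear_holds`)
`Dm(J v x)[J b x] = ∑ₗ dₗ DIₗ(J v x)[J b x]` (for any "jet map" `J` with values in `P` on smooth fields). -/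
theorem fderiv_jet_eq_sum (J : (E3 → E3) → E3 → Jet3) {P : Jet3 → Prop} (hP : ∀ (z w : Jet3) (t : ℝ), P z → P w → P (z + t • w))
    (hPJ : ∀ u : E3 → E3, ContDiff ℝ (⊤ : ℕ∞) u → ∀ x, P (J u x))
    {I : Fin 17 → Jet3 → ℝ} {d : Fin 17 → ℝ} {m : Jet3 → ℝ} (hm : Differentiable ℝ m)
    (hI : ∀ l, Differentiable ℝ (I l)) (hS : ∀ z, P z → m z = ∑ l, d l * I l z)
    {v : E3 → E3} (hv : IsSchwartzField v) (x : E3) :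
    fderiv ℝ m (J v x) (J (eulerBilinear v v) x) = ∑ l, d l * fderiv ℝ (I l) (J v x) (J (eulerBilinear v v) x) := by
  have hvs : ContDiff ℝ (⊤ : ℕ∞) v := ((isSchwartzField_iff v).1 hv).1
  have hbs : ContDiff ℝ (⊤ : ℕ∞) (eulerBilinear v v) := (contDiff_eulerBilinear_holds hv hv).1
  have hm' : Differentiable ℝ (fun z => ∑ l, d l * I l z) :=
    Differentiable.fun_sum fun l _ => (hI l).const_mul (d l)
  rw [fderiv_eq_of_eqOn hP hm hm' hS (hPJ v hvs x) (hPJ _ hbs x),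
    fderiv_fun_sum fun l _ => ((hI l) _).const_mul (d l)]
  simp only [sum_apply, fderiv_const_mul ((hI _) _), smul_apply, smul_eq_mul]

/-- **Integral step.** If pointwise `Dm(J v x)[J b x] = ∑ₗ dₗ DIₗ(J v x)[J b x]` and each `Iₗ - αₗ r` has
vanishing Euler derivative at the divergence-free Schwartz field `v`, then
`∫ Dm(J v x)[J b x] = (∑ₗ dₗ αₗ) ∫ Dr(J v x)[J b x]` (all integrands are integrable by `integrable_fderiv_jets`). -/
theorem integral_jet_eq_mul (J : (E3 → E3) → E3 → Jet3)
    (hJ : ∀ u x, J u x = (u x, iteratedFDeriv ℝ 1 u x, iteratedFDeriv ℝ 2 u x, iteratedFDeriv ℝ 3 u x))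
    {I : Fin 17 → Jet3 → ℝ} {α d : Fin 17 → ℝ} {r m : Jet3 → ℝ}
    (hI : ∀ l, ContDiff ℝ 1 (I l)) (hr : ContDiff ℝ 1 r)
    {v : E3 → E3} (hv : IsSchwartzField v) (hd : VectorCalculus.IsDivFree v)
    (hptw : ∀ x, fderiv ℝ m (J v x) (J (eulerBilinear v v) x) =
      ∑ l, d l * fderiv ℝ (I l) (J v x) (J (eulerBilinear v v) x))
    (hN : ∀ l, ∫ x, fderiv ℝ (fun z => I l z - α l * r z) (J v x) (J (eulerBilinear v v) x) = 0) :
    ∫ x, fderiv ℝ m (J v x) (J (eulerBilinear v v) x) =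
      (∑ l, d l * α l) * ∫ x, fderiv ℝ r (J v x) (J (eulerBilinear v v) x) := by
  have eJ : J = fun u x => (u x, iteratedFDeriv ℝ 1 u x, iteratedFDeriv ℝ 2 u x, iteratedFDeriv ℝ 3 u x) :=
    funext fun u => funext (hJ u)
  have hintI : ∀ l, Integrable fun x => fderiv ℝ (I l) (J v x) (J (eulerBilinear v v) x) := fun l => by
    rw [eJ]
    exact integrable_fderiv_jets (hI l) hv hd
  have hintr : Integrable fun x => fderiv ℝ r (J v x) (J (eulerBilinear v v) x) := by
    rw [eJ]
    exact integrable_fderiv_jets hr hv hd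
  have hdiffr : Differentiable ℝ r := hr.differentiable one_ne_zero
  -- each `∫ DIₗ = αₗ ∫ Dr`
  have hl : ∀ l, ∫ x, fderiv ℝ (I l) (J v x) (J (eulerBilinear v v) x) =
      α l * ∫ x, fderiv ℝ r (J v x) (J (eulerBilinear v v) x) := by
    intro l
    have hdiffI : Differentiable ℝ (I l) := (hI l).differentiable one_ne_zero
    have hexp : ∀ z w : Jet3, fderiv ℝ (fun z => I l z - α l * r z) z w =
        fderiv ℝ (I l) z w - α l * fderiv ℝ r z w := by
      intro z w
      rw [fderiv_fun_sub (hdiffI z) ((hdiffr z).const_mul _), fderiv_const_mul (hdiffr z)]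
      simp only [sub_apply, smul_apply, smul_eq_mul]
    have h0 := hN l
    simp_rw [hexp] at h0
    rw [integral_sub (hintI l) (hintr.const_mul _), integral_const_mul, sub_eq_zero] at h0
    exact h0
  simp_rw [hptw]
  rw [integral_finsetSum _ fun l _ => (hintI l).const_mul (d l)]
  simp_rw [integral_const_mul, hl, Finset.sum_mul, mul_assoc]

/-- **Sign step.** If `Q_m = c · Q_r` on divergence-free Schwartz fields, `Q_m ≥ 0` there and `> 0` once, while
`Q_r` takes both signs, then `False` (`c ≤ 0` and `c ≥ 0`, so `Q_m ≡ 0`). -/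
theorem sign_contra {Qm Qr : (E3 → E3) → ℝ} {c : ℝ}
    (hQ : ∀ v, IsSchwartzField v → VectorCalculus.IsDivFree v → 0 ≤ Qm v)
    (hpos : ∃ v, IsSchwartzField v ∧ VectorCalculus.IsDivFree v ∧ 0 < Qm v)
    (hc : ∀ v, IsSchwartzField v → VectorCalculus.IsDivFree v → Qm v = c * Qr v)
    (hneg : ∃ v, IsSchwartzField v ∧ VectorCalculus.IsDivFree v ∧ Qr v < 0)
    (hpos' : ∃ v, IsSchwartzField v ∧ VectorCalculus.IsDivFree v ∧ 0 < Qr v) : False := by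
  obtain ⟨vm, hsm, hdm, hm⟩ := hneg
  obtain ⟨vp, hsp, hdp, hp⟩ := hpos'
  obtain ⟨v₀, hs₀, hd₀, h₀⟩ := hpos
  have h1 : 0 ≤ c * Qr vm := hc vm hsm hdm ▸ hQ vm hsm hdm
  have h2 : 0 ≤ c * Qr vp := hc vp hsp hdp ▸ hQ vp hsp hdp
  have hle : c ≤ 0 := by nlinarith
  have hge : 0 ≤ c := by nlinarith
  have hc0 : c = 0 := le_antisymm hle hge
  rw [hc v₀ hs₀ hd₀, hc0, zero_mul] at h₀
  exact lt_irrefl 0 h₀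

end IsoAssembleThree

/-- **stub `stub_isoAssembleThree` — the weight-3 endgame.** Given the structure of an invariant weight-3 density on
symmetric jets (`m = ∑ₗ dₗ Iₗ` there), the nullity of the `Iₗ − αₗ r` and smoothness of the `Iₗ` and of `r`, a
Morawetz certificate of weight 3 is contradictory: its Euler derivative is `(∑ dₗ αₗ) · Q_r`, and `Q_r` takes both
signs (`stub_orderThreeLive`), so `Q ≡ 0`, contradicting strictness. -/
theorem stub_isoAssembleThree :
    let e : Fin 3 → E3 := fun i => EuclideanSpace.single i (1 : ℝ);
    let ω : (E3 [×1]→L[ℝ] E3) → E3 := fun A =>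
      WithLp.toLp 2 ![A (fun _ => e 1) 2 - A (fun _ => e 2) 1, A (fun _ => e 2) 0 - A (fun _ => e 0) 2,
        A (fun _ => e 0) 1 - A (fun _ => e 1) 0];
    let r : Jet3 → ℝ := fun z => inner ℝ (ω z.2.1) (z.2.1 (fun _ => ω z.2.1));
    let I0 : Jet3 → ℝ := fun z => ∑ i0 : Fin 3, ∑ i1 : Fin 3, ∑ i2 : Fin 3, z.1 i0 * z.1 i0 * z.2.2.2 ![e i1, e i2, e i2] i1;
    let I1 : Jet3 → ℝ := fun z => ∑ i0 : Fin 3, ∑ i1 : Fin 3, ∑ i2 : Fin 3, z.1 i0 * z.1 i1 * z.2.2.2 ![e i1, e i2, e i2] i0;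
    let I2 : Jet3 → ℝ := fun z => ∑ i0 : Fin 3, ∑ i1 : Fin 3, ∑ i2 : Fin 3, z.1 i0 * z.1 i1 * z.2.2.2 ![e i0, e i1, e i2] i2;
    let I3 : Jet3 → ℝ := fun z => ∑ i0 : Fin 3, ∑ i1 : Fin 3, ∑ i2 : Fin 3, z.1 i0 * z.2.1 (fun _ => e i1) i0 * z.2.2.1 ![e i2, e i2] i1;
    let I4 : Jet3 → ℝ := fun z => ∑ i0 : Fin 3, ∑ i1 : Fin 3, ∑ i2 : Fin 3, z.1 i0 * z.2.1 (fun _ => e i1) i0 * z.2.2.1 ![e i1, e i2] i2;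
    let I5 : Jet3 → ℝ := fun z => ∑ i0 : Fin 3, ∑ i1 : Fin 3, ∑ i2 : Fin 3, z.1 i0 * z.2.1 (fun _ => e i0) i1 * z.2.2.1 ![e i2, e i2] i1;
    let I6 : Jet3 → ℝ := fun z => ∑ i0 : Fin 3, ∑ i1 : Fin 3, ∑ i2 : Fin 3, z.1 i0 * z.2.1 (fun _ => e i0) i1 * z.2.2.1 ![e i1, e i2] i2;
    let I7 : Jet3 → ℝ := fun z => ∑ i0 : Fin 3, ∑ i1 : Fin 3, ∑ i2 : Fin 3, z.1 i0 * z.2.1 (fun _ => e i1) i1 * z.2.2.1 ![e i2, e i2] i0;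
    let I8 : Jet3 → ℝ := fun z => ∑ i0 : Fin 3, ∑ i1 : Fin 3, ∑ i2 : Fin 3, z.1 i0 * z.2.1 (fun _ => e i2) i1 * z.2.2.1 ![e i1, e i2] i0;
    let I9 : Jet3 → ℝ := fun z => ∑ i0 : Fin 3, ∑ i1 : Fin 3, ∑ i2 : Fin 3, z.1 i0 * z.2.1 (fun _ => e i1) i1 * z.2.2.1 ![e i0, e i2] i2;
    let I10 : Jet3 → ℝ := fun z => ∑ i0 : Fin 3, ∑ i1 : Fin 3, ∑ i2 : Fin 3, z.1 i0 * z.2.1 (fun _ => e i2) i1 * z.2.2.1 ![e i0, e i2] i1;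
    let I11 : Jet3 → ℝ := fun z => ∑ i0 : Fin 3, ∑ i1 : Fin 3, ∑ i2 : Fin 3, z.1 i0 * z.2.1 (fun _ => e i2) i1 * z.2.2.1 ![e i0, e i1] i2;
    let I12 : Jet3 → ℝ := fun z => ∑ i0 : Fin 3, ∑ i1 : Fin 3, ∑ i2 : Fin 3, z.2.1 (fun _ => e i0) i0 * z.2.1 (fun _ => e i1) i1 * z.2.1 (fun _ => e i2) i2;
    let I13 : Jet3 → ℝ := fun z => ∑ i0 : Fin 3, ∑ i1 : Fin 3, ∑ i2 : Fin 3, z.2.1 (fun _ => e i0) i0 * z.2.1 (fun _ => e i2) i1 * z.2.1 (fun _ => e i2) i1;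
    let I14 : Jet3 → ℝ := fun z => ∑ i0 : Fin 3, ∑ i1 : Fin 3, ∑ i2 : Fin 3, z.2.1 (fun _ => e i0) i0 * z.2.1 (fun _ => e i2) i1 * z.2.1 (fun _ => e i1) i2;
    let I15 : Jet3 → ℝ := fun z => ∑ i0 : Fin 3, ∑ i1 : Fin 3, ∑ i2 : Fin 3, z.2.1 (fun _ => e i1) i0 * z.2.1 (fun _ => e i2) i0 * z.2.1 (fun _ => e i2) i1;
    let I16 : Jet3 → ℝ := fun z => ∑ i0 : Fin 3, ∑ i1 : Fin 3, ∑ i2 : Fin 3, z.2.1 (fun _ => e i1) i0 * z.2.1 (fun _ => e i0) i2 * z.2.1 (fun _ => e i2) i1;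
    let I : Fin 17 → Jet3 → ℝ := ![I0, I1, I2, I3, I4, I5, I6, I7, I8, I9, I10, I11, I12, I13, I14, I15, I16];
    let α : Fin 17 → ℝ := ![0, -1, 0, 0, 0, 1, 0, 0, 1, 0, 0, 0, 0, 0, 0, -1, 0];
    let Symm : Jet3 → Prop := fun z =>
      (∀ (h : Fin 2 → E3) (σ : Equiv.Perm (Fin 2)), z.2.2.1 (h ∘ σ) = z.2.2.1 h) ∧
      (∀ (h : Fin 3 → E3) (σ : Equiv.Perm (Fin 3)), z.2.2.2 (h ∘ σ) = z.2.2.2 h);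
    let J := fun (v : E3 → E3) (x : E3) => ((v x, iteratedFDeriv ℝ 1 v x, iteratedFDeriv ℝ 2 v x, iteratedFDeriv ℝ 3 v x) : Jet3);
    let Q := fun (m : Jet3 → ℝ) (v : E3 → E3) =>
      -∫ x, fderiv ℝ m (J v x) (J (Literature.Analysis.FluidPDE.eulerBilinear v v) x);
    ∀ (m : Jet3 → ℝ), ContDiff ℝ (⊤ : ℕ∞) m →
      (∀ v, Literature.Analysis.FluidPDE.IsSchwartzField v →
          Literature.Analysis.FluidPDE.VectorCalculus.IsDivFree v → 0 ≤ Q m v) →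
      (∃ v, Literature.Analysis.FluidPDE.IsSchwartzField v ∧
          Literature.Analysis.FluidPDE.VectorCalculus.IsDivFree v ∧ 0 < Q m v) →
      (∃ d : Fin 17 → ℝ, ∀ z : Jet3, Symm z → m z = ∑ l : Fin 17, d l * I l z) →
      (∀ (l : Fin 17) (v : E3 → E3), Literature.Analysis.FluidPDE.IsSchwartzField v →
          Literature.Analysis.FluidPDE.VectorCalculus.IsDivFree v →
          ∫ x, fderiv ℝ (fun z => I l z - α l * r z) (J v x) (J (Literature.Analysis.FluidPDE.eulerBilinear v v) x) = 0) →
      (∀ l : Fin 17, ContDiff ℝ 1 (I l)) → ContDiff ℝ 1 r → False := by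
  intro e ω r I0 I1 I2 I3 I4 I5 I6 I7 I8 I9 I10 I11 I12 I13 I14 I15 I16 I α Symm J Q m hm hQ hpos hS hN hI hr
  obtain ⟨d, hd⟩ := hS
  obtain ⟨-, hneg, hpos'⟩ := stub_orderThreeLive
  refine IsoAssembleThree.sign_contra (Qm := Q m)
    (Qr := fun v => -∫ x, fderiv ℝ r (J v x) (J (eulerBilinear v v) x)) (c := ∑ l, d l * α l) hQ hpos ?_ hneg hpos'
  intro v hv hdv
  show -∫ x, fderiv ℝ m (J v x) (J (eulerBilinear v v) x) =
    (∑ l, d l * α l) * -∫ x, fderiv ℝ r (J v x) (J (eulerBilinear v v) x)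
  rw [IsoAssembleThree.integral_jet_eq_mul J (fun _ _ => rfl) hI hr hv hdv
    (IsoAssembleThree.fderiv_jet_eq_sum J (P := Symm)
      (fun z w t hz hw => IsoAssembleThree.symm_add_smul hz hw t)
      (fun u hu x => IsoAssembleThree.symm_jet hu x) (hm.differentiable (by simp))
      (fun l => (hI l).differentiable one_ne_zero) hd hv)
    (fun l => hN l v hv hdv)]
  ring

end Summit.NavierStokesRegularity.NavierStokesRegularity.Theorems

end
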